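import Literature.Geometry.Lorentzian.KerrTimeDerivativeSupport
import Literature.Geometry.Lorentzian.KerrFluxComparison
import Literature.Geometry.Lorentzian.DyadicDecay
import Mathlib.MeasureTheory.Measure.Prod
import HarnessLib

/-!
# DRSR Corollary 3.1 from Theorems 3.1–3.2 and the Dafermos–Rodnianski `r^p` estimates:
# the assembly of the decay hierarchy on subextremal Kerr

(statement group **gr.S24**; namespace `Literature.Geometry.Lorentzian.Kerr`, glue in
`Literature.Geometry.Lorentzian`)

This file is the next layer of the decomposition of the named fact
`Literature.Geometry.Lorentzian.drsr_wave_polynomial_decay_kerr` (`BlackHoles.lean`;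
Dafermos–Rodnianski–Shlapentokh-Rothman, *Decay for solutions of the wave equation on Kerr
exterior spacetimes III*, arXiv:1402.7034 = Ann. of Math. 183 (2016), "DRSR", Cor. 3.1). The
layers above it are in the tree: `drsr_wave_polynomial_decay_kerr` follows
(`drsr_wave_polynomial_decay_kerr_of_corollary_3_1_scri`, `KerrHyperboloidalFlux.lean`) from the
named fact `Kerr.drsr_corollary_3_1_scri_flux_decay` — DRSR Cor. 3.1, first estimate
`∫_{Σ̃_τ} J^N_μ[ψ] n^μ ≤ C E τ⁻²`, for the concrete foliation `Σ̃_τ(h♯_{R₁}) = {t*_KS = τ + h♯_{R₁}}`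
of the Kerr–Schild exterior chart by hyperboloidal leaves terminating at `𝓘⁺` which coincide
with the Kerr–Schild slices on `{r ≤ R₁}`. DRSR prove Cor. 3.1 in one sentence (§3.3, p. 14 of
the arXiv text): Theorems 3.1 and 3.2 hold with `Σ₀` replaced by an arbitrary admissible
hypersurface `Σ̃₀` (asymptotically flat *or asymptotically hyperboloidal*), by Prop. 4.6.1 of
arXiv:1010.5132, and "as a consequence of this more general statement, the above theorems allow
us to apply our 'black box' result of [arXiv:0910.4957] (see [Schlue] and [Moschidis,
arXiv:1509.08489] for detailed treatments)". The black box (Dafermos–Rodnianski, arXiv:0910.4957,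
§3–§4) consists of the `r^p`-weighted energy estimates for `p = 1, 2` in the far region — whose
error terms, supported in a compact region `{r ∼ R}`, are "controlled (after a bit of averaging
in `R`) by the left hand side of (ILED)" — and a dyadic iteration ("identifying a good dyadic
sequence, applying the boundedness statement, and using the above inequality again with `φ`
replaced by `Tφ`"). The iteration is proved in abstract form in `DyadicDecay.lean`
(`DafermosRodnianski.sq_decay_of_hierarchy`), and the commutation with `T` in
`KerrTimeDerivative.lean` (`IsAdmissibleKerrWave.timeDeriv`), with the ball-support form of the
data hypothesis in `KerrTimeDerivativeSupport.lean`. Here: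

* `Kerr.farLeafFlux` (the flux through `Σ̃_τ(h) ∩ {‖y‖ > R}`, companion of `Kerr.leafFlux`,
  `Kerr.localLeafFlux`), `Kerr.localLeafFlux_add_farLeafFlux` (near/far splitting),
  `Kerr.localLeafMass` (`∫_{‖y‖ ≤ R} ψ² dy` over the part of the leaf over a ball: the zeroth-order
  companion of `Kerr.localLeafFlux`), `Kerr.localError` (the local space-time error functional
  `∫_{[s,t]} (localLeafFlux + localLeafMass)(τ, R) dτ` of the far-region estimates),
  `Kerr.HasBallData` (the data-support hypothesis of `Kerr.drsr_corollary_3_1_scri_flux_decay`);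
* `Kerr.measurable_localLeafFlux_scriHeight` (**proved**): for smooth `ψ` the local flux through
  the slices `{t* = τ} ∩ {‖y‖ ≤ R}` is a measurable function of `τ` (continuity of the energy
  density `T[ψ](V, V)` on the chart, `Kerr.continuous_stressEnergy_timeVector`, and Tonelli) —
  the measurability needed to split `∫ (local + far) dτ` (used by the first version of the
  assembly; kept as infrastructure);
* `Kerr.drsr_theorems_3_1_3_2_scri` (**named fact A**): DRSR Thm. 3.1 (20), (23) and Thm. 3.2 (25),
  (28), (29) with `j = 2, 3`, in the §3.3 form for the hyperboloidal hypersurfaces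
  `Σ̃₀ := Σ̃_s(h♯_{R₁})`, with the higher-order energies `Σ_{i≤j−1} ∫_{Σ̃_τ} J^N[N^iψ] n` kept
  abstract (existentially quantified functions `E₂, E₃` of `τ`; we have no red-shift commutator
  `N`), the first-order flux written with the multiplier `V` (footnote to §3.1), and of (20) only
  its zeroth-order member, on compact regions (clause (A8));
* `Kerr.dafermosRodnianski_pHierarchy_scri` (**named fact B**): the `p = 1` and `p = 2` members of
  the Dafermos–Rodnianski `r^p` hierarchy in the far region of subextremal Kerr for the foliation
  `Σ̃_τ(h♯_{R₁})` **as printed, i.e. with their error terms** — space-time integrals of the first-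
  and zeroth-order quantities `|∂ψ|² + ψ²` over a compact region `{‖y‖ ≤ R'}` between the two
  leaves (`Kerr.localError`), plus energy fluxes through the two leaves (arXiv:0910.4957, §3
  (p-WE-Mink), §4 (p-WE-Schw), "stable under perturbations", asserted for Kerr in §6 and in DRSR
  §3.3; proved for hyperboloidal foliations of general asymptotically flat far regions — a class
  containing the Kerr exterior, loc. cit. §1.3.3 — by Moschidis, arXiv:1509.08489, Thm. 1.1 = Thm.
  5.1 with Lemmas 4.1 and 4.5), with the `p = 1` weighted energy
  `∫_{Σ̃_τ ∩ {r ≥ R}} r (∂_v(rψ))² dv dω + …` kept abstract (an existentially quantified `q`);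
* `Kerr.drsr_corollary_3_1_scri_flux_decay_of_hierarchy` (**proved**): A ∧ B ⟹
  `Kerr.drsr_corollary_3_1_scri_flux_decay`, by `sq_decay_of_hierarchy_of_le_one` applied to
  `f =` flux of `ψ`, `g = E₂`, `q`, with facts A and B used for `ψ` and for `Tψ` (admissible by
  `IsAdmissibleKerrWave.timeDeriv`); hence
  `Literature.Geometry.Lorentzian.drsr_wave_polynomial_decay_kerr_of_hierarchy` and
  `…drsr_wave_local_energy_decay_kerr_of_hierarchy`: **gr.S24 decay rests on the printed
  Theorems 3.1–3.2 of DRSR (fact A) and the printed far-region `r^p` estimates (fact B)**, the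
  iteration and all identifications in between being proved.

## The hierarchy (how A and B feed `sq_decay_of_hierarchy`)

Write `F, F_T` for the `V`-fluxes of `ψ, Tψ` through `Σ̃_τ(h♯_{R₁})`, `E₂ ≤ E₃` and `E₂ᵀ ≤ E₃ᵀ` for
the second and third order energies of fact A for `ψ` and for `Tψ`, `q, q_T` for the `p = 1`
weighted energies of `ψ, Tψ` of fact B, `R'` for the error radius of fact B,
`Loc(s, t) = localError ψ R' s t`, `Loc_T` likewise for `Tψ`, `c = max(C_A, C_B, 1)` (fact A being
taken at the radius `max(R₀^A, R')`) and `B₀ = E₃(0) + E₃ᵀ(0) + D_ψ + D_{Tψ} < ∞`. Then on `[1, ∞)`: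
(EB) `F(t) ≤ c F(s)`, `E₂(t) ≤ c E₂(s)` — (23), (28); (errors) `Loc(s, t) ≤ c (E₂ + F)(s)`,
`Loc_T(s, t) ≤ c (E₂ᵀ + F_T)(s)` — (25) with `j = 2` and the zeroth-order member of (20), from
`Σ̃_s` ((A4), (A8)); (`p = 1`, boundary) `q(t) ≤ C_B (q(s) + F(s) + F(t) + Loc(s, t)) ≤
3c² (q + F + E₂)(s)` — (B1); (`p = 1`, bulk) `∫_{[s,2s]} F ≤ C_B (q(s) + F(s) + F(2s) + Loc(s, 2s))
≤ 3c² (q + F + E₂)(s)` — (B2); (second order) `∫_{[s,2s]} E₂ ≤ C_A (E₃(s) + ∫_{[s,2s]} F +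
∫_{[s,2s]} F_T) ≤ 19 c⁶ B₀` — (A5) = (25) with `j = 3` on the near part plus `N = T` on the far
part (the far fluxes being at most the total ones), then (B2) for `ψ` and `Tψ` and the uniform
bounds `E₃, E₂ᵀ ≲ c B₀`, `F, F_T ≤ c² B₀` ((28), (A6)), `Loc, Loc_T ≤ 2c³ B₀`,
`q(s), q_T(s) ≤ 5c⁴ B₀` ((B1), (B4)); (`p = 2`) `∫_{[s,2s]} q ≤ D_ψ + C_B (F(2s) + Loc(1, 2s)) ≤
4c⁶ B₀` — (B3); data `q(1) + F(1) + E₂(1) ≤ 3c⁶ B₀`. Conclusion: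
`F(τ) ≤ 152 (max 3c² 1)⁶ · 19 c⁶ B₀ · τ⁻²` for `τ ≥ 1`, a finite constant depending on
`(M, a, R₁, ψ)` — exactly the vendored form of Cor. 3.1. No near/far splitting of an integral and
no measurability is needed: (B2) is stated for the total flux, the flux through the near parts
of the leaves being part of `Loc`.

## Review of the split (D-0026, 2026-08-15): why facts A and B were restated

The first version of fact B bounded the error terms of the `p = 1, 2` estimates by `C · F(s)`,
the first-order flux at the earlier leaf. In every source these error terms are printed
*explicitly and locally*: Dafermos–Rodnianski's identities (p-WE-Mink), (p-WE-Schw) carry the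
cylinder term `∫_{τ₁}^{τ₂} r^p (|∇̸ψ|² ± (∂_vψ)²) dτ|_{r=R}` (`ψ = rφ`, so of first *and zeroth*
order in `φ`), "controlled … by the left hand side of (ILED)", their (ILED-Mink), (ILED1-Schw)
containing `φ²` on `{r ≤ R}`; Moschidis' Thm. 1.1 = Thm. 5.1 has right-hand side
`E^{(p)}_bound[φ](τ₁) + ∫_{𝓡(τ₁,τ₂)} |∂χ_R| (r^p |∂φ|² + r^{p−2} φ²)` (+ source terms). Turning
these local space-time errors into `C · F(s)` *is* DRSR's Theorem 3.1 (20) (with (23)) — so the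
first version of B silently contained (20), while fact A, which quotes (20), transcribed none of
it (its (A4) is (25) with `j = 2`, first order with loss; the zeroth-order integrated decay exists
nowhere else in the tree). The cut between "the deep input" (A) and "the far-region
computation" (B) thus ran through the middle of Theorem 3.1, and B was not provable without
first proving (20). The restatement moves the line back to where the sources draw it: B now
carries its printed local error functional `Kerr.localError` (first plus zeroth order) and the
energy fluxes through both leaves (the later one is produced by the energy identity; it is
admitted on the right for convenience — in the source it is controlled by the far-region
`T`-energy estimate, Moschidis Lemma 4.5, in the assembly by (23)); A gains the clause (A8), the
zeroth-order member of (20) on compact regions from `Σ̃_s`, which the assembly needs to absorb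
the zeroth-order errors (the first-order ones are absorbed by (A4), losing one derivative, which
the iteration tolerates). B is now true independently of DRSR and is a far-region statement
about the Kerr metric in the Kerr–Schild chart (multiplier currents `r^p ∂_v`, `f(r)∂_r` and `T`
on `{r ≥ R}`, the graph energy identities of `KerrSchildMultiplierEnergyIdentity.lean`, Hardy
inequalities); A is Theorems 3.1–3.2 as before, by one printed clause more complete.

## Design choices

* **Abstract higher-order energies.** The right-hand sides of (25) and (28) are
  `Σ_{i≤j−1} ∫_{Σ̃₀} J^N_μ[N^iψ] n^μ` with `N` the red-shift vector field of DRSR Prop. 4.5.1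
  (`φ_τ`-invariant, timelike up to and on `𝓗⁺`, `N = T` for `r ≥ r₁(a, M)`), equivalent by the
  elliptic estimate (29) to `Σ_{1≤i≤j} ‖ψ‖²_{H̊^i(Σ̃)} + ‖n_{Σ̃}ψ‖²_{H̊^{i−1}(Σ̃)}`. The prelude has no
  `N`, and the `T`-commuted first-order fluxes `∫ J[Tψ] + J[ψ]` need not control these where
  `T` fails to be timelike (the ergoregion, which for `a` close to `M` meets the physical-space
  projection of trapping): stating (25) with `∫ J^V[Tψ] + J^V[ψ]` on the right would assert more
  than DRSR print. We therefore quantify existentially over functions `E₂, E₃ : ℝ → ℝ≥0∞` having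
  the printed properties of the `j = 2, 3` energies; each clause of fact A is a printed
  inequality ((20), (23), (25), (28)) or a consequence of (29) and the definitions, for these
  quantities. An existential weakening asserts less than the source, never more.
* **Abstract `p`-weighted energy, concrete error terms.** Likewise fact B quantifies
  existentially over the `p = 1` weighted energy `q(τ)` (Moschidis' `E^{(1)}_bound[ψ](τ)`:
  `∫_{Σ̃_τ ∩ {r ≥ R}} r (∂_v(rψ))² dv dω` plus lower-order and `T`-flux terms), whose outgoing
  null derivative the prelude does not have, and over a finite data constant `D` (the `p = 2`
  weighted energy through `Σ̃₁`); but its error terms are the concrete functionals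
  `Kerr.localError … ψ R' s t` and `Kerr.leafFlux`, so that B asserts exactly the printed
  far-region estimates and nothing about the near region.
* **No measurability hypotheses on `E₂, E₃, q`** and no splitting of integrals of sums: the
  iteration of `DyadicDecay.lean` needs none, (B2) bounds the total flux, and `Kerr.localError`
  is a sum of two integrals rather than the integral of a sum.
* **Finiteness.** The finiteness clauses are (A7), `E₃(0) < ∞` — the data induced on
  `Σ̃₀(h♯_{R₁})` by an admissible wave whose data on `{t* = 0}` are supported in `{‖y‖ ≤ R₁}` are
  smooth and compactly supported (they coincide with the given data on `{r ≤ R₁}`, where the leaf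
  is the slice, and vanish beyond, the part `{r > R₁}` of the leaf lying outside the domain of
  influence of the data — (ii)–(iii) of *The corrected foliation* in `KerrHyperboloidalFlux.lean`,
  arXiv:1010.5132, Prop. 4.5.1), so every weighted higher-order energy of DRSR's data class
  (§4.1) is finite — and `D < ∞` in fact B (the `p = 2` weighted energy through `Σ̃₁`, finite by
  the `p = 2` estimate from `Σ̃₀`, where the data are compactly supported). All other finiteness
  is *derived* ((A6): `F, F_T ≤ C E₂ ≤ C E₃`).
* Binders use `Kerr.region a (Kerr.rPlus M a)` for `Kerr.exterior M a` (definitionally equal;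
  implementation note of `KerrHyperboloidalFlux.lean`).

## References

* M. Dafermos, I. Rodnianski, Y. Shlapentokh-Rothman, *Decay for solutions of the wave equation
  on Kerr exterior spacetimes III: the full subextremal case `|a| < M`*, Ann. of Math. 183 (2016)
  787–913, arXiv:1402.7034: §2.2.3 (`ζ`, `Z̃*`: degeneration only at trapping), §3.1 Thm. 3.1
  (20), (23) and the footnote on `N`, §3.2 Thm. 3.2 (25), (28), (29), §3.3 (admissible `Σ̃₀` of
  the second kind; Cor. 3.1), §4.1 (data), Prop. 4.5.1 (`N`, `N = T` for `r ≥ r₁`)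
  (key `DafermosRodnianskiShlapentokhrothman2014`).
* M. Dafermos, I. Rodnianski, *A new physical-space approach to decay for the wave equation with
  applications to black hole spacetimes*, XVIth ICMP (2010) 421–432, arXiv:0910.4957, §3
  ((ILED-Mink), (p-WE-Mink), (eq:1), (biv), (finalest)), §4 ((EB-Schw), (ILED1/2-Schw),
  (p-WE-Schw), final display), §6 (general formulation; "Of particular importance are the Kerr
  spacetimes") (key `DafermosRodnianski2010ICMP`).
* G. Moschidis, *The `r^p`-weighted energy method of Dafermos and Rodnianski in general
  asymptotically flat spacetimes and applications*, Ann. PDE 2 (2016), arXiv:1509.08489: §1.3.3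
  (subextremal Kerr satisfies the geometric assumptions; restatement of DRSR Cor. 3.1), §3.1
  (hyperboloidal hypersurfaces terminating at `𝓘⁺`, `du dσ ∼ r^{-1-η'} dv dσ` on them), Lemma 4.1
  (far-region `∂_r`-Morawetz estimate), Lemma 4.5 (far-region `J^T`-energy estimate), Thm. 5.1
  (= Thm. 1.1, the `r^p` hierarchy between two hyperboloids, `0 < p ≤ 2`, with
  `E^{(p)}_bound`, `E^{(p−1)}_bulk`), Thm. 7.1 (radiation field), Thm. 8.1 (= Thm. 1.3, decay
  from ILED with loss) (key `Moschidis2016`).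
* M. Dafermos, I. Rodnianski, *Decay for solutions of the wave equation on Kerr exterior
  spacetimes I–II*, arXiv:1010.5132, §4.4 (admissible hypersurfaces), Prop. 4.5.1, Prop. 4.6.1
  (key `DafermosRodnianski2010KerrSmallA`).
-/

noncomputable section

open Bundle Set TopologicalSpace Filter MeasureTheory Metric
open scoped Manifold ContDiff Topology ENNReal NNReal

namespace Literature.Geometry.Lorentzian

namespace Kerr

/-! ### Far fluxes and the near/far splitting of the leaf flux -/

/-- The **far flux** `∫_{Σ̃_τ(h) ∩ {‖y‖ > R}} J^V_μ[ψ] n^μ dσ`: the flux of the `V`-current through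
the part of the leaf `Σ̃_τ(h)` over the complement of the closed coordinate ball of radius `R`
(companion of `Kerr.leafFlux`, `Kerr.localLeafFlux`); the quantity estimated by the `p = 1`
member of the Dafermos–Rodnianski `r^p` hierarchy in the far region (arXiv:0910.4957, §3–§4:
`∫_{τ_{n-1}}^{τ_n} ∫_{N_τ} J^T_α n^α`). [cite: DafermosRodnianski2010ICMP, §4] -/
def farLeafFlux [Facts] (M a : ℝ) (h : E3 → ℝ) (ψ : region a (rPlus M a) → ℝ) (τ R : ℝ) : ℝ≥0∞ :=
  ∫⁻ y in (closedBall (0 : E3) R)ᶜ, leafFluxDensity M a h ψ τ y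

/-- **Near/far splitting**: `∫_{Σ̃_τ} J n = ∫_{Σ̃_τ ∩ {‖y‖ ≤ R}} J n + ∫_{Σ̃_τ ∩ {‖y‖ > R}} J n`.
[folklore] -/
theorem localLeafFlux_add_farLeafFlux [Facts] (M a : ℝ) (h : E3 → ℝ)
    (ψ : region a (rPlus M a) → ℝ) (τ R : ℝ) :
    localLeafFlux M a h ψ τ R + farLeafFlux M a h ψ τ R = leafFlux M a h ψ τ :=
  lintegral_add_compl _ measurableSet_closedBall

/-- The far flux is at most the total flux. [folklore] -/
theorem farLeafFlux_le_leafFlux [Facts] (M a : ℝ) (h : E3 → ℝ) (ψ : region a (rPlus M a) → ℝ)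
    (τ R : ℝ) : farLeafFlux M a h ψ τ R ≤ leafFlux M a h ψ τ :=
  setLIntegral_le_lintegral _ _

/-- The far flux of the zero field vanishes. [folklore] -/
theorem farLeafFlux_zero [Facts] (M a : ℝ) (h : E3 → ℝ) (τ R : ℝ) :
    farLeafFlux M a h (fun _ ↦ 0) τ R = 0 :=
  le_antisymm ((farLeafFlux_le_leafFlux M a h _ τ R).trans_eq (leafFlux_zero M a h τ)) zero_le

/-! ### Local masses and the local space-time error functional of the far-region estimates -/

open scoped Classical in
/-- The **mass density** `ψ(τ + h y, y)²` of `ψ` on the leaf `Σ̃_τ(h)` over `y ∈ E3`, as an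
extended non-negative real, and `0` if the leaf point is not in the exterior `{r > r₊}`
(zeroth-order companion of `Kerr.leafFluxDensity`; the integrand of the zeroth-order terms
`∫ φ²` of (ILED-Mink), (ILED1-Schw) of arXiv:0910.4957 and of the last term of DRSR (20)).
[cite: DafermosRodnianski2010ICMP, §3 (ILED-Mink), §4 (ILED1-Schw)] -/
def leafMassDensity (M a : ℝ) (h : E3 → ℝ) (ψ : region a (rPlus M a) → ℝ) (τ : ℝ) (y : E3) :
    ℝ≥0∞ :=
  if hy : leafPoint h τ y ∈ region a (rPlus M a) then ENNReal.ofReal (ψ ⟨leafPoint h τ y, hy⟩ ^ 2)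
  else 0

/-- Off the exterior the mass density is `0`. [folklore] -/
theorem leafMassDensity_of_not_mem {M a : ℝ} (h : E3 → ℝ) (ψ : region a (rPlus M a) → ℝ) (τ : ℝ)
    {y : E3} (hy : leafPoint h τ y ∉ region a (rPlus M a)) : leafMassDensity M a h ψ τ y = 0 := by
  simp [leafMassDensity, hy]

/-- The **local mass** `∫_{‖y‖ ≤ R} ψ(τ + h y, y)² dy` of `ψ` on the part of the leaf `Σ̃_τ(h)`
over the closed coordinate ball of radius `R` (zeroth-order companion of `Kerr.localLeafFlux`):
the quantity whose time integral over compact regions is controlled by the zeroth-order members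
of the integrated local energy decay estimates, `∫_τ^∞ ∫_{r ≤ R} φ²` in (ILED-Mink)/(ILED1-Schw)
of arXiv:0910.4957, `∫_{𝓡₀} r^{-3-δ}(ψ − ψ_∞)²` in DRSR (20).
[cite: DafermosRodnianski2010ICMP, §3 (ILED-Mink), §4 (ILED1-Schw)] -/
def localLeafMass (M a : ℝ) (h : E3 → ℝ) (ψ : region a (rPlus M a) → ℝ) (τ R : ℝ) : ℝ≥0∞ :=
  ∫⁻ y in closedBall (0 : E3) R, leafMassDensity M a h ψ τ y

/-- The local mass is monotone in the radius. [folklore] -/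
theorem localLeafMass_mono (M a : ℝ) (h : E3 → ℝ) (ψ : region a (rPlus M a) → ℝ) (τ : ℝ)
    {R R' : ℝ} (hRR' : R ≤ R') : localLeafMass M a h ψ τ R ≤ localLeafMass M a h ψ τ R' :=
  lintegral_mono_set (closedBall_subset_closedBall hRR')

/-- The local mass of the zero field vanishes. [folklore] -/
theorem localLeafMass_zero (M a : ℝ) (h : E3 → ℝ) (τ R : ℝ) :
    localLeafMass M a h (fun _ : region a (rPlus M a) ↦ 0) τ R = 0 := by
  have : leafMassDensity M a h (fun _ : region a (rPlus M a) ↦ (0 : ℝ)) τ = fun _ ↦ 0 := by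
    funext y
    by_cases hy : leafPoint h τ y ∈ region a (rPlus M a)
    · simp [leafMassDensity, hy]
    · exact leafMassDensity_of_not_mem h _ τ hy
  simp [localLeafMass, this]

/-- The **local space-time error functional** of the far-region estimates:
`Loc_R(s, t) = ∫_{[s,t]} localLeafFlux(τ, R) dτ + ∫_{[s,t]} localLeafMass(τ, R) dτ`, the
first-order `V`-flux plus the mass of `ψ` through the parts of the leaves `Σ̃_τ(h)`, `τ ∈ [s, t]`,
over the closed coordinate ball of radius `R`, integrated in `τ`. Under `(τ, y) ↦ (τ + h y, y)`
(Jacobian `1`; `dt* dy` is the metric volume of the Kerr–Schild chart, `det g = −1`) this is the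
space-time integral of `T[ψ](V, W) + ψ²` over the region between `Σ̃_s(h)` and `Σ̃_t(h)` above the
ball — the shape of the printed error terms of the `r^p` hierarchy and of the far-region Morawetz
and `T`-energy estimates, `∫_{J⁺(𝓢₁) ∩ J⁻(𝓢₂) ∩ {r ∼ R}} (|∂φ|² + |φ|²)` (Moschidis,
arXiv:1509.08489, Thm. 1.1, Thm. 5.1, Lemmas 4.1, 4.5: `∫_{𝓡(τ₁,τ₂)} |∂χ_R| (r^p|∂φ|² + r^{p−2}φ²)`;
Dafermos–Rodnianski, arXiv:0910.4957, the cylinder terms of (p-WE-Mink), (p-WE-Schw) "after a bit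
of averaging in `R`"). A sum of two integrals (no measurability is presupposed).
[cite: Moschidis2016, Thm. 5.1 (right-hand side)] -/
def localError [Facts] (M a : ℝ) (h : E3 → ℝ) (ψ : region a (rPlus M a) → ℝ) (R s t : ℝ) :
    ℝ≥0∞ :=
  (∫⁻ τ in Icc s t, localLeafFlux M a h ψ τ R) + ∫⁻ τ in Icc s t, localLeafMass M a h ψ τ R

/-- The local error functional is monotone in the radius. [folklore] -/
theorem localError_mono [Facts] (M a : ℝ) (h : E3 → ℝ) (ψ : region a (rPlus M a) → ℝ) (s t : ℝ)
    {R R' : ℝ} (hRR' : R ≤ R') : localError M a h ψ R s t ≤ localError M a h ψ R' s t :=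
  add_le_add (lintegral_mono fun τ ↦ localLeafFlux_mono M a h ψ τ hRR')
    (lintegral_mono fun τ ↦ localLeafMass_mono M a h ψ τ hRR')

/-- The local error functional of the zero field vanishes. [folklore] -/
theorem localError_zero [Facts] (M a : ℝ) (h : E3 → ℝ) (R s t : ℝ) :
    localError M a h (fun _ : region a (rPlus M a) ↦ 0) R s t = 0 := by
  have h1 : (fun τ ↦ localLeafFlux M a h (fun _ : region a (rPlus M a) ↦ (0 : ℝ)) τ R) =
      fun _ ↦ 0 := by
    funext τ
    exact le_antisymm ((localLeafFlux_le_leafFlux M a h _ τ R).trans_eq (leafFlux_zero M a h τ))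
      zero_le
  have h2 : (fun τ ↦ localLeafMass M a h (fun _ : region a (rPlus M a) ↦ (0 : ℝ)) τ R) =
      fun _ ↦ 0 := by
    funext τ
    exact localLeafMass_zero M a h τ R
  simp [localError, h1, h2]

/-! ### The two named facts: DRSR Theorems 3.1–3.2 (§3.3 form) and the `r^p` estimates -/

/-- Abbreviation used in the statements below: the data of `ψ` on the Kerr–Schild slice
`{t* = 0} ∩ {r > r₊}` are supported in the closed coordinate ball of radius `R₁` (`ψ = 0` and
`dψ = 0` at the slice points with `‖x⃗‖ > R₁`; the support hypothesis of
`Kerr.drsr_corollary_3_1_scri_flux_decay`). DRSR arXiv:1402.7034, §4.1. [cite: DafermosRodnianskiShlapentokhrothman2014, §4.1] -/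
def HasBallData (M a R₁ : ℝ) (ψ : region a (rPlus M a) → ℝ) : Prop :=
  ∀ x : region a (rPlus M a), (x : E4) 0 = 0 → R₁ < E4.spatialNorm (x : E4) →
    ψ x = 0 ∧ mfderiv 𝓘(ℝ, E4) 𝓘(ℝ, ℝ) ψ x = 0

/-- Monotonicity of the support radius. [folklore] -/
theorem HasBallData.mono {M a R₁ R₂ : ℝ} {ψ : region a (rPlus M a) → ℝ} (h : HasBallData M a R₁ ψ)
    (hR : R₁ ≤ R₂) : HasBallData M a R₂ ψ :=
  fun x hx0 hx ↦ h x hx0 (hR.trans_lt hx)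

/-- The zero field has data supported in every ball. [folklore] -/
theorem hasBallData_zero (M a R₁ : ℝ) : HasBallData M a R₁ (fun _ : region a (rPlus M a) ↦ 0) :=
  fun _ _ _ ↦ ⟨rfl, mfderiv_const⟩

/-- For `M ≥ 0`, the time derivative of an admissible wave with data in the ball of radius `R₁`
has data in the same ball (`IsAdmissibleKerrWave.timeDeriv_data_eq_zero_of_lt_spatialNorm`,
`KerrTimeDerivativeSupport.lean`). DRSR arXiv:1402.7034, §4.1. [cite: DafermosRodnianskiShlapentokhrothman2014, §4.1] -/
theorem HasBallData.timeDeriv [Facts] [SliceFacts] {M a R₁ : ℝ} (hM : 0 ≤ M)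
    {ψ : region a (rPlus M a) → ℝ} (hψ : Literature.Geometry.Lorentzian.IsAdmissibleKerrWave M a ψ)
    (h : HasBallData M a R₁ ψ) : HasBallData M a R₁ (timeDeriv ψ) :=
  hψ.timeDeriv_data_eq_zero_of_lt_spatialNorm hM h

/-- **Dafermos–Rodnianski–Shlapentokh-Rothman, Theorems 3.1 and 3.2 for the hyperboloidal
hypersurfaces `Σ̃_s(h♯_{R₁})`** (named fact, D-0014). As printed (arXiv:1402.7034 = Ann. of Math.
183 (2016)): for `M > 0`, `0 ≤ a₀ < M`, `|a| ≤ a₀`, `δ > 0`, `j ≥ 1` there is `C = C(a₀, M, δ, j)`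
such that sufficiently regular solutions of `□_{g_{a,M}} ψ = 0` on `𝓡₀ = D⁺(Σ₀)` satisfy
(20) `∫_{𝓡₀} (r⁻¹ζ|∇̸ψ|² + r^{-1-δ}ζ(Tψ)² + r^{-1-δ}(Z̃*ψ)² + r^{-3-δ}(ψ−ψ_∞)²) ≤ C ∫_{Σ₀} J^N[ψ]n`,
(23) `∫_{Σ_τ} J^N[ψ] n ≤ C ∫_{Σ₀} J^N[ψ] n` (`τ ≥ 0`),
(25) `∫_{𝓡₀} r^{-1-δ}ζ Σ_{1≤i₁+i₂+i₃≤j} |∇̸^{i₁}T^{i₂}(Z̃*)^{i₃}ψ|² + r^{-1-δ} Σ_{1≤i₁+i₂+i₃≤j−1}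
(|∇̸^{i₁}T^{i₂}(Z̃*)^{i₃+1}ψ|² + |∇̸^{i₁}T^{i₂}(Z*)^{i₃}ψ|²) ≤ C ∫_{Σ₀} Σ_{i≤j−1} J^N[N^iψ] n`,
(28) `∫_{Σ_τ} Σ_{i≤j−1} J^N[N^iψ] n ≤ C ∫_{Σ₀} Σ_{i≤j−1} J^N[N^iψ] n` (`τ ≥ 0`), and
(29) `∫_{Σ_τ} Σ_{i≤j−1} J^N[N^iψ] n ∼ Σ_{1≤i≤j} ‖ψ‖²_{H̊^i(Σ_τ)} + ‖n_{Σ_τ}ψ‖²_{H̊^{i−1}(Σ_τ)}`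
(elliptic estimate); here `4πψ_∞² = lim_{r'→∞} ∫_{Σ₀ ∩ {r=r'}} r⁻²ψ²`, `ζ` and `Z̃*` degenerate only
on the trapping interval `[3M − s⁻, 3M + s⁺]` (§2.2.3), `N` is the red-shift vector field of
Prop. 4.5.1 (`φ_τ`-invariant, timelike on `𝓡` including `𝓗⁺`, `N = T` for `r ≥ r₁(a, M)`), and
(§3.3, p. 14, by Prop. 4.6.1 of arXiv:1010.5132) all of this holds with `Σ₀` replaced by any
admissible hypersurface `Σ̃₀` of the first or second kind — in particular an asymptotically
hyperboloidal one terminating at null infinity —, `Σ_τ` by `Σ̃_τ = φ_τ(Σ̃₀)`, `𝓡₀` by `D⁺(Σ̃₀)`,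
with `N` kept (the constant then also depending on `Σ̃₀`).
**Vendored form.** For `|a| < M` there is `R₀ = R₀(M, a) > 0` such that for all `R₁, R ≥ R₀` there
is `C = C(M, a, R₁, R) < ∞` such that for every admissible wave `ψ` (`IsAdmissibleKerrWave`) with
data supported in `{‖y‖ ≤ R₁}` (`HasBallData`) there are functions `E₂, E₃ : ℝ → ℝ≥0∞` — standing
for the printed `Σ_{i≤1} ∫_{Σ̃_τ} J^N[N^iψ] n` and `Σ_{i≤2} ∫_{Σ̃_τ} J^N[N^iψ] n` through the leaves
`Σ̃_τ = Σ̃_τ(h♯_{R₁})` (`Kerr.scriHeight`; `KerrHyperboloidalFlux.lean`), which we do not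
construct (module docstring, *Design choices*) — such that, with `F(τ) = leafFlux … ψ τ`,
`F_T(τ) = leafFlux … (Tψ) τ` the `V`-fluxes (`V = −g♯dt*`, admissible as "`N`" in the first-order
statements by the footnote to §3.1) and `0 ≤ s ≤ t`:
(A1) `F(t) ≤ C F(s)` — (23) from `Σ̃_s`; (A2) `E₂(t) ≤ C E₂(s)`, (A3) `E₃(t) ≤ C E₃(s)` — (28),
`j = 2, 3`, from `Σ̃_s`; (A4) `∫_{[s,t]} localLeafFlux(τ, R) dτ ≤ C E₂(s)` — (25), `j = 2`, from
`Σ̃_s`, restricted to the parts over `{‖y‖ ≤ R}` of the leaves `Σ̃_τ`, `τ ∈ [s, t]`, whose union lies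
in `D⁺(Σ̃_s) ∩ {r ≤ R + |a|}` (under `(τ, y) ↦ (τ + h♯(y), y)` the coordinate volume `dτ dy` is the
metric volume, `det g = −1`; over the ball the leaves are uniformly spacelike, so the flux density
is `≤ C(M, a, R₁, R) ∑(∂ψ)²`, cf. `Kerr.stressEnergy_timeVector_le_sum_sq_of_isSubextremal` where
the leaf is the slice; and the second line of (25) with `j = 2`, `|∇̸ψ|² + |Tψ|² + |Z*ψ|²`, is
non-degenerate at first order: trapping costs one derivative); (A5) `∫_{[s,t]} E₂(τ) dτ ≤
C (E₃(s) + ∫_{[s,t]} far_ψ(τ, R) dτ + ∫_{[s,t]} far_{Tψ}(τ, R) dτ)` — the near part `{r ≤ R}` of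
`E₂(τ)` has density `≲ |∂ψ|² + |∂²ψ|²`, whose space-time integral is bounded by (25) with `j = 3`
from `Σ̃_s`, and on the far part `N = T` (`R ≥ R₀ ≥ r₁ + |a| + 1`) and `J^T·n ≤ C J^V·n`
(`T = V + 2Hℓ♯`, dominant energy), whence `≤ C (farLeafFlux ψ + farLeafFlux (Tψ))`;
(A6) `F(τ) ≤ C E₂(τ)`, `F_T(τ) ≤ C E₂(τ)`, `E₂(τ) ≤ E₃(τ)` (`τ ≥ 0`) — comparability of the `V`- and
`N`-fluxes (two `φ_τ`-invariant timelike fields equal/asymptotic to `T` far out), `Tψ = Nψ +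
(T − N)ψ` with `T − N` supported in `{r ≤ r₁}`, where the leaves are the slices and the local
elliptic estimate behind (29) applies, and the definitions; (A7) `E₃(0) < ∞` — the data induced
on `Σ̃₀(h♯_{R₁})` are smooth and compactly supported (§4.1; they are the given data on `{r ≤ R₁}`
and vanish beyond, the part `{r > R₁}` of the leaf lying outside the domain of influence of
`{t* = 0, ‖y‖ ≤ R₁}`: arXiv:1010.5132, Prop. 4.5.1 and (iii) of *The corrected foliation* in
`KerrHyperboloidalFlux.lean`); (A8) `∫_{[s,t]} localLeafMass(τ, R) dτ ≤ C F(s)` — the zeroth-order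
member of (20), `∫_{D⁺(Σ̃_s)} r^{-3-δ}(ψ − ψ_∞)² ≤ C ∫_{Σ̃_s} J^N[ψ] n` with `δ = 1`, from `Σ̃_s`,
restricted to the same union of leaf parts over `{‖y‖ ≤ R}` (there `r^{-4} ≥ (R + |a|)^{-4}`),
where `ψ_∞ = 0` on every `Σ̃_s` for the solutions considered (along a hypersurface terminating at
`𝓘⁺` the spherical means of `ψ²` tend to `0`, `rψ` being bounded near `𝓘⁺` in `D⁺(Σ̃₀(h♯_{R₁}))` for
data of compact support: the radiation field exists, arXiv:1509.08489 Thm. 7.1, equivalently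
Cor. 3.1's `sup_{Σ̃_τ} r|ψ − ψ_∞| ≤ C√E τ^{-1/2}` with `ψ_∞ = 0` computed on `Σ̃₀`, where `ψ`
vanishes near infinity), and `∫_{Σ̃_s} J^N n ≤ C F(s)` as in (A1). `ψ` is a sufficiently regular
solution on `D⁺(Σ̃_s) ∩ {r > r₊} ⊆ {t* ≥ 0}` (it coincides there with the smooth solution of the
zero-extended data, loc. cit. (ii)). The vendored statement is weaker than the source
(existential `E₂, E₃`; one `δ = 1`; `j ≤ 3`; of (20) only the zeroth-order member on compact
regions; the constants merged). Instance hypotheses `[Kerr.Facts] [Kerr.SliceFacts]` supply the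
Kerr metric and its Levi-Civita connection.
[cite: DafermosRodnianskiShlapentokhrothman2014, Thm. 3.1 (20) (23), Thm. 3.2 (25) (28) (29), §3.3 p. 14, Prop. 4.5.1] -/
def drsr_theorems_3_1_3_2_scri : Prop :=
  ∀ [Facts] [SliceFacts] (M a : ℝ), IsSubextremal M a →
    ∃ R₀ : ℝ, 0 < R₀ ∧ ∀ R₁ R : ℝ, R₀ ≤ R₁ → R₀ ≤ R →
      ∃ C : ℝ≥0∞, C < ⊤ ∧ ∀ ψ : region a (rPlus M a) → ℝ,
        Literature.Geometry.Lorentzian.IsAdmissibleKerrWave M a ψ → HasBallData M a R₁ ψ →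
        ∃ E₂ E₃ : ℝ → ℝ≥0∞,
          -- (A1) Thm. 3.1 (23), §3.3 form: boundedness of the first-order flux
          (∀ s t : ℝ, 0 ≤ s → s ≤ t →
            leafFlux M a (scriHeight M a R₁) ψ t ≤ C * leafFlux M a (scriHeight M a R₁) ψ s) ∧
          -- (A2) Thm. 3.2 (28), j = 2: boundedness of the second-order energy
          (∀ s t : ℝ, 0 ≤ s → s ≤ t → E₂ t ≤ C * E₂ s) ∧
          -- (A3) Thm. 3.2 (28), j = 3
          (∀ s t : ℝ, 0 ≤ s → s ≤ t → E₃ t ≤ C * E₃ s) ∧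
          -- (A4) Thm. 3.2 (25), j = 2, on `{‖y‖ ≤ R}`: integrated local energy decay, losing one
          -- derivative
          (∀ s t : ℝ, 0 ≤ s → s ≤ t →
            ∫⁻ τ in Icc s t, localLeafFlux M a (scriHeight M a R₁) ψ τ R ≤ C * E₂ s) ∧
          -- (A5) Thm. 3.2 (25), j = 3, on `{r ≤ R}`, plus `N = T` on `{r > R}`
          (∀ s t : ℝ, 0 ≤ s → s ≤ t →
            ∫⁻ τ in Icc s t, E₂ τ ≤ C * (E₃ s +
              (∫⁻ τ in Icc s t, farLeafFlux M a (scriHeight M a R₁) ψ τ R) +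
                ∫⁻ τ in Icc s t, farLeafFlux M a (scriHeight M a R₁) (timeDeriv ψ) τ R)) ∧
          -- (A6) (29) and the definitions: first-order fluxes of `ψ`, `Tψ` below `E₂ ≤ E₃`
          (∀ τ : ℝ, 0 ≤ τ →
            leafFlux M a (scriHeight M a R₁) ψ τ ≤ C * E₂ τ ∧
            leafFlux M a (scriHeight M a R₁) (timeDeriv ψ) τ ≤ C * E₂ τ ∧ E₂ τ ≤ E₃ τ) ∧
          -- (A7) §4.1: the higher-order weighted energy of the data is finite
          E₃ 0 < ⊤ ∧
          -- (A8) Thm. 3.1 (20), zeroth-order member, on `{‖y‖ ≤ R}` (`ψ_∞ = 0`): integrated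
          -- local decay of the mass, without loss
          (∀ s t : ℝ, 0 ≤ s → s ≤ t →
            ∫⁻ τ in Icc s t, localLeafMass M a (scriHeight M a R₁) ψ τ R ≤
              C * leafFlux M a (scriHeight M a R₁) ψ s)

/-- **The `p = 1` and `p = 2` weighted energy estimates of Dafermos–Rodnianski in the far region
of subextremal Kerr, for the foliation `Σ̃_τ(h♯_{R₁})`, with their printed error terms** (named
fact, D-0014). As printed for Minkowski and Schwarzschild space (arXiv:0910.4957, §3 (p-WE-Mink),
§4 (p-WE-Schw); `ψ = rφ`, `D_{τ₁}^{τ₂} = {r ≥ R} ∩ {τ₁ ≤ u ≤ τ₂}`, `R` large):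
`∫_{u=τ₂, v ≥ τ₂+R} r^p (∂_vψ)² dv + ∫_{D_{τ₁}^{τ₂}} r^{p−1}(p(∂_vψ)² + (2−p)|∇̸ψ|²) du dv +
∫_{𝓘⁺} r^p|∇̸ψ|² ≤ C (∫_{u=τ₁, v≥τ₁+R} r^p(∂_vψ)² dv + ∫_{τ₁}^{τ₂} r^p(|∇̸ψ|² + (∂_vψ)²) dτ|_{r=R})`
(an identity with `=` and `|∇̸ψ|² − (∂_vψ)²` in the cylinder term for `M = 0`), the last term — of
first and zeroth order in `φ` — being "controlled (after a bit of averaging in `R`) by the left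
hand side of (ILED)"; with the Hardy identity `∫(∂_v(rφ))² dv = ∫ r²(∂_vφ)² dv − rφ²|` the `p = 1`
bulk term bounds the energy flux through the far, null parts of the leaves ((eq:1) before the
addition of (ILED)); "the results apply to a wide class of background metrics … Of particular
importance are the Kerr spacetimes" (loc. cit. §6; "the hierarchy … is stable under suitable
perturbations of the background metric", as summarised by Moschidis, arXiv:1509.08489, p. 5),
invoked for subextremal Kerr by DRSR (arXiv:1402.7034, §3.3: Cor. 3.1 "as a consequence" of
Thms. 3.1–3.2 and "our black box result of [0910.4957]"). Proved,
for pairs of spacelike hyperboloidal hypersurfaces `𝓢₁, 𝓢₂ ⊂ J⁺(𝓢₁)` terminating at `𝓘⁺` in the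
far region `{r ≥ R}` of a general asymptotically flat spacetime — a class containing the Kerr
exterior, §1.3.3 — by Moschidis (arXiv:1509.08489, Thm. 1.1, in detail Thm. 5.1, `0 < p ≤ 2`, `d = 3`):
`E^{(p)}_bound[φ](τ₂) + ∫_{τ₁}^{τ₂} E^{(p−1)}_bulk[φ](τ) dτ + (𝓘⁺ terms) ≲_{p,η,δ} E^{(p)}_bound[φ](τ₁)
+ ∫_{𝓡(τ₁,τ₂)} |∂χ_R| (r^p|∂φ|² + r^{p−2}φ²)` (+ source terms), where
`E^{(p)}_bound[φ](τ) = ∫_{𝓢_τ} χ_R (r^p|∂_v(Ωφ)|² + r^{-1-η'}(r^p|r⁻¹∂_σ(Ωφ)|² + min{r^{p−2}, r^{−δ}}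
|Ωφ|²)) dv dσ + ∫_{𝓢_τ} χ_R J^T_μ(φ) n̄^μ` and `E^{(p−1)}_bulk[φ](τ) = ∫_{𝓢_τ} χ_R (p r^{p−1}|∂_v(Ωφ)|² +
((2−p)r^{p−1} + r^{p−1−δ})|r⁻¹∂_σ(Ωφ)|² + min{r^{p−3}, r^{-1-δ}}|Ωφ|² + r^{-1-η}|∂_u(Ωφ)|²) dv dσ`
(`Ω = r(1 + O(r⁻¹))`, `χ_R` a cut-off supported in `{r ≥ R}`, `du dσ ∼ r^{-1-η'} dv dσ` on the
hyperboloids, §3.1), the transversal derivatives in the bulk coming from the far-region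
`∂_r`-Morawetz estimate Lemma 4.1 and the `T`-fluxes from the far-region energy estimate
Lemma 4.5, both with right-hand sides `∫_{supp ∂χ} |∂χ|(|∂φ|² + r⁻²φ²)` plus energy fluxes
through `𝓢_{τ₁}`, `𝓢_{τ₂}`. For `p = 1` the bulk density dominates the (degenerate) energy flux
density through the hyperboloids, so `∫_{τ₁}^{τ₂} (flux through 𝓢_τ ∩ {r ≥ R}) dτ ≲ E^{(1)}_bound(τ₁)
+ errors`; for `p = 2` it dominates `E^{(1)}_bound`.
**Vendored form.** For `|a| < M` there is `R₀ = R₀(M, a) > 0` such that for every `R₁ ≥ R₀` there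
are `C = C(M, a, R₁) < ∞` and an error radius `R' = R'(M, a, R₁)` such that for every admissible
wave `ψ` with data supported in `{‖y‖ ≤ R₁}` there are a function `q : ℝ → ℝ≥0∞` — standing for
the `p = 1` weighted energy `E^{(1)}_bound[ψ](τ)` through the far parts of the leaves
`Σ̃_τ = Σ̃_τ(h♯_{R₁})` (which terminate at `𝓘⁺`, approaching the outgoing null cones at the rate
`du/dv = O(M²r⁻²)`, `Kerr.outgoingNullSlope_sub_scriSlope`; so `η' = 1`), which we do not
construct — and a finite `D = D(ψ)` (`C ×` the `p = 2` weighted energy `E^{(2)}_bound[ψ](1)`,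
finite by the `p = 2` estimate from `Σ̃₀`, on which the data are compactly supported) such that,
with `F(τ) = leafFlux … ψ τ` the `V`-flux through `Σ̃_τ` and
`Loc(s, t) = localError … ψ R' s t = ∫_{[s,t]} localLeafFlux(τ, R') dτ + ∫_{[s,t]} localLeafMass(τ, R') dτ`
the local space-time error functional over `{‖y‖ ≤ R'}` between `Σ̃_s` and `Σ̃_t` (containing the
cut-off regions `{r ∼ R}` of all the currents):
(B1) `q(t) ≤ C (q(s) + F(s) + F(t) + Loc(s, t))` for `1 ≤ s ≤ t` — `p = 1`, the boundary terms;
(B2) `∫_{[s,2s]} F(τ) dτ ≤ C (q(s) + F(s) + F(2s) + Loc(s, 2s))` for `s ≥ 1` — `p = 1`, the bulk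
term: it bounds the flux through the far parts `{‖y‖ > R'}` of the leaves `Σ̃_τ`, `τ ∈ [s, 2s]`
(tangential derivatives and mass by `E^{(0)}_bulk` and Hardy, the transversal derivative, whose
weight in the flux density of these leaves is `O(M²r⁻²) ≤ r^{-1-η}`, by the `∂_r`-Morawetz member),
while the flux through the near parts is at most `Loc(s, 2s)`;
(B3) `∫_{[s,2s]} q(τ) dτ ≤ D + C (F(2s) + Loc(1, 2s))` for `s ≥ 1` — `p = 2` from `Σ̃₁`, the bulk
term (`E^{(1)}_bound ≲ E^{(1)}_bulk`); (B4) `q(1) ≤ D`.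
The flux through the later leaf (`F(t)`, `F(2s)`), which the energy identities produce with the
good sign, is admitted on the right-hand sides (in the source it is controlled by Lemma 4.5, in
the assembly by (23)). The space-time regions involved lie in `D⁺(Σ̃₁) ∩ {r > r₊} ⊆ {t* ≥ 1}`,
where `ψ` is a smooth solution. The vendored statement is weaker than the source (existential
`q`, `R'`; only `p = 1, 2`; dyadic intervals; merged constants; extra flux terms on the right).
Nothing is asserted about the near region: every error term is explicit. Instance hypotheses
`[Kerr.Facts] [Kerr.SliceFacts]` supply the Kerr metric and its Levi-Civita connection.
[cite: Moschidis2016, Thm. 5.1 (p = 1, 2) with Lemma 4.1, Lemma 4.5, §3.1, §1.3.3; DafermosRodnianski2010ICMP §3 (p-WE-Mink) (eq:1), §4 (p-WE-Schw), §6; DafermosRodnianskiShlapentokhrothman2014 §3.3] -/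
def dafermosRodnianski_pHierarchy_scri : Prop :=
  ∀ [Facts] [SliceFacts] (M a : ℝ), IsSubextremal M a →
    ∃ R₀ : ℝ, 0 < R₀ ∧ ∀ R₁ : ℝ, R₀ ≤ R₁ →
      ∃ (C : ℝ≥0∞) (R' : ℝ), C < ⊤ ∧ ∀ ψ : region a (rPlus M a) → ℝ,
        Literature.Geometry.Lorentzian.IsAdmissibleKerrWave M a ψ → HasBallData M a R₁ ψ →
        ∃ (q : ℝ → ℝ≥0∞) (D : ℝ≥0∞), D < ⊤ ∧
          -- (B1) p = 1, boundary terms, between `Σ̃_s` and `Σ̃_t`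
          (∀ s t : ℝ, 1 ≤ s → s ≤ t →
            q t ≤ C * (q s + leafFlux M a (scriHeight M a R₁) ψ s +
              leafFlux M a (scriHeight M a R₁) ψ t + localError M a (scriHeight M a R₁) ψ R' s t)) ∧
          -- (B2) p = 1, bulk term: the flux through the leaves, integrated over a dyadic interval
          (∀ s : ℝ, 1 ≤ s →
            ∫⁻ τ in Icc s (2 * s), leafFlux M a (scriHeight M a R₁) ψ τ ≤
              C * (q s + leafFlux M a (scriHeight M a R₁) ψ s +
                leafFlux M a (scriHeight M a R₁) ψ (2 * s) +
                localError M a (scriHeight M a R₁) ψ R' s (2 * s))) ∧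
          -- (B3) p = 2 from `Σ̃₁`, bulk term
          (∀ s : ℝ, 1 ≤ s →
            ∫⁻ τ in Icc s (2 * s), q τ ≤
              D + C * (leafFlux M a (scriHeight M a R₁) ψ (2 * s) +
                localError M a (scriHeight M a R₁) ψ R' 1 (2 * s))) ∧
          -- (B4) the `p = 1` weighted energy at time `1` is bounded by the data constant
          q 1 ≤ D


/-! ### Measurability in time of the local flux through the Kerr–Schild slices -/

section measurability

/-- The coordinate derivative components `x ↦ dψ_x(w)` of a smooth function on a chart domain
are continuous (they are `∂_wψ̃` for the zero extension). [folklore] -/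
theorem continuous_dcov_apply {a r₀ : ℝ} {ψ : region a r₀ → ℝ}
    (hψ : ContMDiff 𝓘(ℝ, E4) 𝓘(ℝ, ℝ) ∞ ψ) (w : E4) :
    Continuous fun x : region a r₀ ↦ dcov ψ x w := by
  have hrep : (fun x : region a r₀ ↦ dcov ψ x w) =
      fun x : region a r₀ ↦ fderiv ℝ (Function.extend Subtype.val ψ 0) (x : E4) w := by
    funext x
    rw [← mvfderiv_apply_eq_dcov, mvfderiv_eq_fderiv_extend]
  rw [hrep]
  refine continuous_iff_continuousAt.2 fun x ↦ ?_
  have h : ContinuousAt (fderiv ℝ (Function.extend Subtype.val ψ 0)) (x : E4) :=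
    ((contDiffAt_extend hψ x).fderiv_right (m := 0) (by simp)).continuousAt
  exact (h.comp continuous_subtype_val.continuousAt).clm_apply continuousAt_const

/-- `x ↦ H(x)` is continuous on a chart domain (`r > 0` there). [folklore] -/
theorem continuous_scalarH_restrict (M a r₀ : ℝ) :
    Continuous fun x : region a r₀ ↦ scalarH M a x :=
  continuous_iff_continuousAt.2 fun x ↦
    (contDiffAt_scalarH M a (radius_pos_of_mem_region x.2) (n := 0)).continuousAt.comp
      continuous_subtype_val.continuousAt

/-- `x ↦ ℓ_μ(x)` is continuous on a chart domain. [folklore] -/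
theorem continuous_nullCovectorFun_restrict (a r₀ : ℝ) (μ : Fin 4) :
    Continuous fun x : region a r₀ ↦ nullCovectorFun a x μ :=
  continuous_iff_continuousAt.2 fun x ↦
    (contDiffAt_nullCovectorFun a (radius_pos_of_mem_region x.2) (n := 0) μ).continuousAt.comp
      continuous_subtype_val.continuousAt

variable [Facts]

/-- **The energy density `x ↦ T[ψ](V, V)(x)` of a smooth function is continuous on the chart
domain** (through the explicit Kerr–Schild expression `Kerr.two_mul_stressEnergy_timeVector`).
[folklore] -/
theorem continuous_stressEnergy_timeVector (M a r₀ : ℝ) {ψ : region a r₀ → ℝ}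
    (hψ : ContMDiff 𝓘(ℝ, E4) 𝓘(ℝ, ℝ) ∞ ψ) :
    Continuous fun x : region a r₀ ↦
      (smoothMetric M a r₀).stressEnergy ψ x (timeVector M a x.1) (timeVector M a x.1) := by
  have heq : (fun x : region a r₀ ↦
      (smoothMetric M a r₀).stressEnergy ψ x (timeVector M a x.1) (timeVector M a x.1)) =
      fun x ↦ (1 / 2 : ℝ) * (2 * (smoothMetric M a r₀).stressEnergy ψ x (timeVector M a x.1)
        (timeVector M a x.1)) := by
    funext x; ring
  rw [heq]
  refine continuous_const.mul ?_
  simp_rw [two_mul_stressEnergy_timeVector]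
  have hH := continuous_scalarH_restrict M a r₀
  have hl := continuous_nullCovectorFun_restrict a r₀
  have hd := fun μ ↦ continuous_dcov_apply hψ (E4.basisVector μ)
  fun_prop

open scoped Classical in
/-- Measurability of the cut-off energy density `x ↦ 1_{r > r₊} T[ψ](V, V)(x)` on `E4`, as an
extended non-negative real (continuous on the open exterior, zero outside). [folklore] -/
theorem measurable_sliceDensity (M a : ℝ) {ψ : region a (rPlus M a) → ℝ}
    (hψ : ContMDiff 𝓘(ℝ, E4) 𝓘(ℝ, ℝ) ∞ ψ) :
    Measurable fun x : E4 ↦ if hx : x ∈ region a (rPlus M a) then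
      ENNReal.ofReal ((smoothMetric M a (rPlus M a)).stressEnergy ψ ⟨x, hx⟩ (timeVector M a x)
        (timeVector M a x)) else 0 := by
  refine Measurable.dite (f := fun x : (region a (rPlus M a) : Set E4) ↦
      ENNReal.ofReal ((smoothMetric M a (rPlus M a)).stressEnergy ψ x (timeVector M a x.1)
        (timeVector M a x.1))) ?_ measurable_const (region a (rPlus M a)).2.measurableSet
  exact (ENNReal.continuous_ofReal.comp (continuous_stressEnergy_timeVector M a _ hψ)).measurable

open scoped Classical in
/-- On the coordinate ball `{‖y‖ ≤ R}`, `R < R₁`, the flux density of the leaf `Σ̃_τ(h♯_{R₁})`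
over `y` is the cut-off slice density at `(τ, y)` (the leaf is the Kerr–Schild slice there).
[folklore] -/
theorem leafFluxDensity_scriHeight_eq_dite {M a R R₁ : ℝ} (hR₁ : 0 ≤ R₁) (hR : R < R₁)
    (ψ : region a (rPlus M a) → ℝ) (τ : ℝ) {y : E3} (hy : ‖y‖ ≤ R) :
    leafFluxDensity M a (scriHeight M a R₁) ψ τ y =
      if hx : E4.ofTimeSpace τ y ∈ region a (rPlus M a) then
        ENNReal.ofReal ((smoothMetric M a (rPlus M a)).stressEnergy ψ ⟨E4.ofTimeSpace τ y, hx⟩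
          (timeVector M a (E4.ofTimeSpace τ y)) (timeVector M a (E4.ofTimeSpace τ y))) else 0 := by
  by_cases hx : E4.ofTimeSpace τ y ∈ region a (rPlus M a)
  · rw [dif_pos hx]
    exact leafFluxDensity_scriHeight_of_norm_le hR₁ hR ψ τ hy hx
  · rw [dif_neg hx]
    have h0 : scriHeight M a R₁ y = 0 := scriHeight_eq_zero_of_norm_le hR₁ (hy.trans hR.le)
    exact leafFluxDensity_of_not_mem _ _ _ (by rwa [leafPoint_of_eq_zero h0])

/-- **The local flux through the slices is a measurable function of time**: for smooth `ψ` and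
`R < R₁`, `τ ↦ ∫_{‖y‖ ≤ R} J^V_μ[ψ] n^μ (τ, y) dy` through `Σ̃_τ(h♯_{R₁}) ∩ {‖y‖ ≤ R} = {t* = τ}
∩ {‖y‖ ≤ R}` is measurable (Tonelli, the integrand being jointly measurable in `(τ, y)`). This is
the measurability needed to split `∫ (local + far) dτ` (`lintegral_add_left`; used by the first
version of the assembly, kept as infrastructure for the far-region estimates). [folklore] -/
theorem measurable_localLeafFlux_scriHeight {M a R R₁ : ℝ} (hR₁ : 0 ≤ R₁) (hR : R < R₁)
    {ψ : region a (rPlus M a) → ℝ} (hψ : ContMDiff 𝓘(ℝ, E4) 𝓘(ℝ, ℝ) ∞ ψ) :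
    Measurable fun τ : ℝ ↦ localLeafFlux M a (scriHeight M a R₁) ψ τ R := by
  classical
  set G : E4 → ℝ≥0∞ := fun x ↦ if hx : x ∈ region a (rPlus M a) then
      ENNReal.ofReal ((smoothMetric M a (rPlus M a)).stressEnergy ψ ⟨x, hx⟩ (timeVector M a x)
        (timeVector M a x)) else 0 with hGdef
  have hG : Measurable G := measurable_sliceDensity M a hψ
  -- rewrite the local flux as an integral over `E3` of a jointly measurable function
  have heq : (fun τ : ℝ ↦ localLeafFlux M a (scriHeight M a R₁) ψ τ R) =
      fun τ ↦ ∫⁻ y : E3, (closedBall (0 : E3) R).indicator (fun y ↦ G (E4.ofTimeSpace τ y)) y := by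
    funext τ
    rw [localLeafFlux, ← lintegral_indicator measurableSet_closedBall]
    refine lintegral_congr fun y ↦ ?_
    by_cases hy : y ∈ closedBall (0 : E3) R
    · rw [indicator_of_mem hy, indicator_of_mem hy]
      exact leafFluxDensity_scriHeight_eq_dite hR₁ hR ψ τ (mem_closedBall_zero_iff.mp hy)
    · rw [indicator_of_notMem hy, indicator_of_notMem hy]
  rw [heq]
  refine Measurable.lintegral_prod_right (f := fun (τ : ℝ) (y : E3) ↦
    (closedBall (0 : E3) R).indicator (fun y ↦ G (E4.ofTimeSpace τ y)) y) ?_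
  -- joint measurability
  have hcont : Continuous fun p : ℝ × E3 ↦ E4.ofTimeSpace p.1 p.2 := by
    have : (fun p : ℝ × E3 ↦ E4.ofTimeSpace p.1 p.2) =
        fun p ↦ p.1 • E4.basisVector 0 + E4.ofTimeSpace 0 p.2 := by
      funext p
      ext μ
      refine Fin.cases ?_ (fun i ↦ ?_) μ
      · simp [E4.ofTimeSpace_apply_zero]
      · simp [E4.ofTimeSpace_apply_succ, E4.basisVector, Fin.succ_ne_zero]
    rw [this]
    exact (continuous_fst.smul continuous_const).add
      ((E4.continuous_ofTimeSpace 0).comp continuous_snd)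
  have h1 : Measurable fun p : ℝ × E3 ↦ G (E4.ofTimeSpace p.1 p.2) := hG.comp hcont.measurable
  have h2 : Measurable fun p : ℝ × E3 ↦ (closedBall (0 : E3) R).indicator (fun _ ↦ (1 : ℝ≥0∞)) p.2 :=
    (measurable_const.indicator measurableSet_closedBall).comp measurable_snd
  have h3 : (Function.uncurry fun (τ : ℝ) (y : E3) ↦
      (closedBall (0 : E3) R).indicator (fun y ↦ G (E4.ofTimeSpace τ y)) y) =
      fun p ↦ (closedBall (0 : E3) R).indicator (fun _ ↦ (1 : ℝ≥0∞)) p.2 *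
        G (E4.ofTimeSpace p.1 p.2) := by
    funext p
    rcases p with ⟨τ, y⟩
    by_cases hy : y ∈ closedBall (0 : E3) R
    · simp [Function.uncurry, indicator_of_mem hy]
    · simp [Function.uncurry, indicator_of_notMem hy]
  rw [h3]
  exact h2.mul h1

end measurability


/-! ### The assembly: Corollary 3.1 from Theorems 3.1–3.2 and the `r^p` estimates -/

section assembly

/-- `x ≤ c x` for `c ≥ 1` in `ℝ≥0∞`. [folklore] -/
theorem le_const_mul_self {c : ℝ≥0∞} (hc : 1 ≤ c) (x : ℝ≥0∞) : x ≤ c * x :=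
  le_mul_of_one_le_left zero_le hc

/-- **DRSR Corollary 3.1 (first estimate, foliation `Σ̃_τ(h♯_{R₁})`) from Theorems 3.1–3.2 and
the `r^p` estimates.** `Kerr.drsr_theorems_3_1_3_2_scri` (fact A) and
`Kerr.dafermosRodnianski_pHierarchy_scri` (fact B) imply `Kerr.drsr_corollary_3_1_scri_flux_decay`:
this is the sentence of DRSR, arXiv:1402.7034, §3.3 ("as a consequence of this more general
statement, the above theorems allow us to apply our black box result") with the black box run
explicitly — the dyadic iteration `DafermosRodnianski.sq_decay_of_hierarchy_of_le_one`
(arXiv:0910.4957, §4, final display) for `f = F` (flux of `ψ`), `g = E₂`, `q`, on `[1, ∞)`, with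
constant `3 (max(C_A, C_B, 1))²` and data bound
`19 max(C_A, C_B, 1)⁶ (E₃(0) + E₃ᵀ(0) + D_ψ + D_{Tψ})`, facts A and B being applied to `ψ` and to `Tψ` (`IsAdmissibleKerrWave.timeDeriv`,
`.timeDeriv_data_eq_zero_of_lt_spatialNorm`; `M > 0`), fact A at the radius `max(R₀^A, R')` so
that its integrated decay estimates (A4) (first order, with loss) and (A8) (zeroth order) absorb
the local error functional of fact B — "the last term … can be controlled … by the left hand side
of (ILED)" (arXiv:0910.4957, §3) — and the far fluxes of (A5) being at most the total ones
(module docstring, *The hierarchy*). The threshold radius is `max(R₀^A, R₀^B)`.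
[cite: DafermosRodnianskiShlapentokhrothman2014, §3.3 Cor. 3.1; DafermosRodnianski2010ICMP §3–§4] -/
theorem drsr_corollary_3_1_scri_flux_decay_of_hierarchy
    (hA : drsr_theorems_3_1_3_2_scri) (hB : dafermosRodnianski_pHierarchy_scri) :
    drsr_corollary_3_1_scri_flux_decay := by
  intro _ _ M a hMa
  obtain ⟨RA, hRA, hA⟩ := hA M a hMa
  obtain ⟨RB, hRB, hB⟩ := hB M a hMa
  refine ⟨max RA RB, lt_max_of_lt_left hRA, fun R₁ hR₁ ψ hψ hsupp ↦ ?_⟩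
  have hRA1 : RA ≤ R₁ := (le_max_left _ _).trans hR₁
  have hRB1 : RB ≤ R₁ := (le_max_right _ _).trans hR₁
  have hM : 0 ≤ M := hMa.pos.le
  -- `Tψ` is admissible with the same data support
  have hball : HasBallData M a R₁ ψ := hsupp
  have hTψ : Literature.Geometry.Lorentzian.IsAdmissibleKerrWave M a (timeDeriv ψ) :=
    hψ.timeDeriv hM
  have hTball : HasBallData M a R₁ (timeDeriv ψ) := hball.timeDeriv hM hψ
  -- fact B for `ψ` and for `Tψ`: constant `CB`, error radius `R'`
  obtain ⟨CB, R', hCB, hBψ⟩ := hB R₁ hRB1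
  obtain ⟨q, D, hD, hB1, hB2, hB3, hB4⟩ := hBψ ψ hψ hball
  obtain ⟨qT, DT, hDT, hBT1, hBT2, -, hBT4⟩ := hBψ (timeDeriv ψ) hTψ hTball
  -- fact A at the radius `RA' = max RA R'`, for `ψ` and for `Tψ`
  set RA' : ℝ := max RA R' with hRA'def
  obtain ⟨CA, hCA, hAψ⟩ := hA R₁ RA' hRA1 (le_max_left _ _)
  obtain ⟨E₂, E₃, hA1, hA2, hA3, hA4, hA5, hA6, hA7, hA8⟩ := hAψ ψ hψ hball
  obtain ⟨E₂T, E₃T, -, hAT2, -, hAT4, -, hAT6, hAT7, hAT8⟩ := hAψ (timeDeriv ψ) hTψ hTball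
  -- one constant `c ≥ 1` dominating `CA`, `CB`
  set c : ℝ≥0∞ := max (max CA CB) 1 with hcdef
  have hc_top : c < ⊤ := max_lt (max_lt hCA hCB) ENNReal.one_lt_top
  have hCAc : CA ≤ c := (le_max_left _ _).trans (le_max_left _ _)
  have hCBc : CB ≤ c := (le_max_right _ _).trans (le_max_left _ _)
  have h1c : 1 ≤ c := le_max_right _ _
  have hpow : ∀ {m n : ℕ}, m ≤ n → c ^ m ≤ c ^ n := fun h ↦ pow_le_pow_right₀ h1c h
  have hcpow : ∀ n : ℕ, 1 ≤ n → c ≤ c ^ n := fun n hn ↦ by simpa using hpow hn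
  -- abbreviations for the fluxes and the local error functionals
  set F : ℝ → ℝ≥0∞ := fun τ ↦ leafFlux M a (scriHeight M a R₁) ψ τ with hFdef
  set FT : ℝ → ℝ≥0∞ := fun τ ↦ leafFlux M a (scriHeight M a R₁) (timeDeriv ψ) τ with hFTdef
  set L : ℝ → ℝ → ℝ≥0∞ := fun s t ↦ localError M a (scriHeight M a R₁) ψ R' s t with hLdef
  set LT : ℝ → ℝ → ℝ≥0∞ := fun s t ↦ localError M a (scriHeight M a R₁) (timeDeriv ψ) R' s t
    with hLTdef
  -- the local error functionals below the integrated decay estimates (A4), (A8) of fact A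
  have hL : ∀ s t, 0 ≤ s → s ≤ t → L s t ≤ c * E₂ s + c * F s := fun s t hs hst ↦
    calc L s t ≤ localError M a (scriHeight M a R₁) ψ RA' s t :=
          localError_mono M a _ ψ s t (le_max_right _ _)
      _ ≤ CA * E₂ s + CA * F s := add_le_add (hA4 s t hs hst) (hA8 s t hs hst)
      _ ≤ c * E₂ s + c * F s := add_le_add (mul_le_mul' hCAc le_rfl) (mul_le_mul' hCAc le_rfl)
  have hLT : ∀ s t, 0 ≤ s → s ≤ t → LT s t ≤ c * E₂T s + c * FT s := fun s t hs hst ↦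
    calc LT s t ≤ localError M a (scriHeight M a R₁) (timeDeriv ψ) RA' s t :=
          localError_mono M a _ (timeDeriv ψ) s t (le_max_right _ _)
      _ ≤ CA * E₂T s + CA * FT s := add_le_add (hAT4 s t hs hst) (hAT8 s t hs hst)
      _ ≤ c * E₂T s + c * FT s := add_le_add (mul_le_mul' hCAc le_rfl) (mul_le_mul' hCAc le_rfl)
  -- the data bound
  set B₀ : ℝ≥0∞ := E₃ 0 + E₃T 0 + D + DT with hB₀def
  have hB₀_top : B₀ < ⊤ :=
    ENNReal.add_lt_top.2 ⟨ENNReal.add_lt_top.2 ⟨ENNReal.add_lt_top.2 ⟨hA7, hAT7⟩, hD⟩, hDT⟩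
  have hE₃B : E₃ 0 ≤ B₀ := (le_self_add.trans le_self_add).trans le_self_add
  have hE₃TB : E₃T 0 ≤ B₀ := le_add_self.trans (le_self_add.trans le_self_add)
  have hDB : D ≤ B₀ := le_add_self.trans le_self_add
  have hDTB : DT ≤ B₀ := le_add_self
  have hB₀c : ∀ n : ℕ, B₀ ≤ c ^ n * B₀ := fun n ↦
    calc B₀ = c ^ 0 * B₀ := by rw [pow_zero, one_mul]
      _ ≤ c ^ n * B₀ := mul_le_mul' (hpow (Nat.zero_le n)) le_rfl
  -- Step 0: uniform bounds by the data on `[0, ∞)` (resp. `[1, ∞)`)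
  have hE₃ : ∀ τ, 0 ≤ τ → E₃ τ ≤ c * B₀ := fun τ hτ ↦
    calc E₃ τ ≤ CA * E₃ 0 := hA3 0 τ le_rfl hτ
      _ ≤ c * B₀ := mul_le_mul' hCAc hE₃B
  have hE₂ : ∀ τ, 0 ≤ τ → E₂ τ ≤ c * B₀ := fun τ hτ ↦
    calc E₂ τ ≤ CA * E₂ 0 := hA2 0 τ le_rfl hτ
      _ ≤ c * B₀ := mul_le_mul' hCAc ((hA6 0 le_rfl).2.2.trans hE₃B)
  have hE₂T : ∀ τ, 0 ≤ τ → E₂T τ ≤ c * B₀ := fun τ hτ ↦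
    calc E₂T τ ≤ CA * E₂T 0 := hAT2 0 τ le_rfl hτ
      _ ≤ c * B₀ := mul_le_mul' hCAc ((hAT6 0 le_rfl).2.2.trans hE₃TB)
  have hF : ∀ τ, 0 ≤ τ → F τ ≤ c ^ 2 * B₀ := fun τ hτ ↦
    calc F τ ≤ CA * E₂ τ := (hA6 τ hτ).1
      _ ≤ c * (c * B₀) := mul_le_mul' hCAc (hE₂ τ hτ)
      _ = c ^ 2 * B₀ := by ring
  have hFT : ∀ τ, 0 ≤ τ → FT τ ≤ c ^ 2 * B₀ := fun τ hτ ↦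
    calc FT τ ≤ CA * E₂ τ := (hA6 τ hτ).2.1
      _ ≤ c * (c * B₀) := mul_le_mul' hCAc (hE₂ τ hτ)
      _ = c ^ 2 * B₀ := by ring
  have hLB : ∀ s t, 0 ≤ s → s ≤ t → L s t ≤ 2 * c ^ 3 * B₀ := fun s t hs hst ↦
    calc L s t ≤ c * E₂ s + c * F s := hL s t hs hst
      _ ≤ c * (c * B₀) + c * (c ^ 2 * B₀) := add_le_add (mul_le_mul' le_rfl (hE₂ s hs))
          (mul_le_mul' le_rfl (hF s hs))
      _ = c ^ 2 * B₀ + c ^ 3 * B₀ := by ring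
      _ ≤ c ^ 3 * B₀ + c ^ 3 * B₀ := add_le_add (mul_le_mul' (hpow (by norm_num)) le_rfl) le_rfl
      _ = 2 * c ^ 3 * B₀ := by ring
  have hLTB : ∀ s t, 0 ≤ s → s ≤ t → LT s t ≤ 2 * c ^ 3 * B₀ := fun s t hs hst ↦
    calc LT s t ≤ c * E₂T s + c * FT s := hLT s t hs hst
      _ ≤ c * (c * B₀) + c * (c ^ 2 * B₀) := add_le_add (mul_le_mul' le_rfl (hE₂T s hs))
          (mul_le_mul' le_rfl (hFT s hs))
      _ = c ^ 2 * B₀ + c ^ 3 * B₀ := by ring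
      _ ≤ c ^ 3 * B₀ + c ^ 3 * B₀ := add_le_add (mul_le_mul' (hpow (by norm_num)) le_rfl) le_rfl
      _ = 2 * c ^ 3 * B₀ := by ring
  have hq : ∀ s, 1 ≤ s → q s ≤ 5 * c ^ 4 * B₀ := fun s hs ↦ by
    have hs0 : (0 : ℝ) ≤ s := by linarith
    calc q s ≤ CB * (q 1 + F 1 + F s + L 1 s) := hB1 1 s le_rfl hs
      _ ≤ c * (B₀ + c ^ 2 * B₀ + c ^ 2 * B₀ + 2 * c ^ 3 * B₀) :=
          mul_le_mul' hCBc (add_le_add (add_le_add (add_le_add (hB4.trans hDB)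
            (hF 1 zero_le_one)) (hF s hs0)) (hLB 1 s zero_le_one hs))
      _ ≤ c * (c ^ 3 * B₀ + c ^ 3 * B₀ + c ^ 3 * B₀ + 2 * c ^ 3 * B₀) :=
          mul_le_mul' le_rfl (add_le_add (add_le_add (add_le_add (hB₀c 3)
            (mul_le_mul' (hpow (by norm_num)) le_rfl)) (mul_le_mul' (hpow (by norm_num)) le_rfl))
            le_rfl)
      _ = 5 * c ^ 4 * B₀ := by ring
  have hqT : ∀ s, 1 ≤ s → qT s ≤ 5 * c ^ 4 * B₀ := fun s hs ↦ by
    have hs0 : (0 : ℝ) ≤ s := by linarith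
    calc qT s ≤ CB * (qT 1 + FT 1 + FT s + LT 1 s) := hBT1 1 s le_rfl hs
      _ ≤ c * (B₀ + c ^ 2 * B₀ + c ^ 2 * B₀ + 2 * c ^ 3 * B₀) :=
          mul_le_mul' hCBc (add_le_add (add_le_add (add_le_add (hBT4.trans hDTB)
            (hFT 1 zero_le_one)) (hFT s hs0)) (hLTB 1 s zero_le_one hs))
      _ ≤ c * (c ^ 3 * B₀ + c ^ 3 * B₀ + c ^ 3 * B₀ + 2 * c ^ 3 * B₀) :=
          mul_le_mul' le_rfl (add_le_add (add_le_add (add_le_add (hB₀c 3)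
            (mul_le_mul' (hpow (by norm_num)) le_rfl)) (mul_le_mul' (hpow (by norm_num)) le_rfl))
            le_rfl)
      _ = 5 * c ^ 4 * B₀ := by ring
  -- the integrated fluxes over dyadic intervals are bounded by the data ((B2) for `ψ`, `Tψ`)
  have hIF : ∀ s, 1 ≤ s → ∫⁻ u in Icc s (2 * s), F u ≤ 9 * c ^ 5 * B₀ := fun s hs ↦ by
    have hs0 : (0 : ℝ) ≤ s := by linarith
    have hs2 : (0 : ℝ) ≤ 2 * s := by linarith
    have hss : s ≤ 2 * s := by linarith
    calc ∫⁻ u in Icc s (2 * s), F u ≤ CB * (q s + F s + F (2 * s) + L s (2 * s)) := hB2 s hs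
      _ ≤ c * (5 * c ^ 4 * B₀ + c ^ 2 * B₀ + c ^ 2 * B₀ + 2 * c ^ 3 * B₀) :=
          mul_le_mul' hCBc (add_le_add (add_le_add (add_le_add (hq s hs) (hF s hs0))
            (hF (2 * s) hs2)) (hLB s (2 * s) hs0 hss))
      _ ≤ c * (5 * c ^ 4 * B₀ + c ^ 4 * B₀ + c ^ 4 * B₀ + 2 * c ^ 4 * B₀) :=
          mul_le_mul' le_rfl (add_le_add (add_le_add (add_le_add le_rfl
            (mul_le_mul' (hpow (by norm_num)) le_rfl)) (mul_le_mul' (hpow (by norm_num)) le_rfl))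
            (mul_le_mul' (mul_le_mul' le_rfl (hpow (by norm_num))) le_rfl))
      _ = 9 * c ^ 5 * B₀ := by ring
  have hIFT : ∀ s, 1 ≤ s → ∫⁻ u in Icc s (2 * s), FT u ≤ 9 * c ^ 5 * B₀ := fun s hs ↦ by
    have hs0 : (0 : ℝ) ≤ s := by linarith
    have hs2 : (0 : ℝ) ≤ 2 * s := by linarith
    have hss : s ≤ 2 * s := by linarith
    calc ∫⁻ u in Icc s (2 * s), FT u ≤ CB * (qT s + FT s + FT (2 * s) + LT s (2 * s)) :=
          hBT2 s hs
      _ ≤ c * (5 * c ^ 4 * B₀ + c ^ 2 * B₀ + c ^ 2 * B₀ + 2 * c ^ 3 * B₀) :=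
          mul_le_mul' hCBc (add_le_add (add_le_add (add_le_add (hqT s hs) (hFT s hs0))
            (hFT (2 * s) hs2)) (hLTB s (2 * s) hs0 hss))
      _ ≤ c * (5 * c ^ 4 * B₀ + c ^ 4 * B₀ + c ^ 4 * B₀ + 2 * c ^ 4 * B₀) :=
          mul_le_mul' le_rfl (add_le_add (add_le_add (add_le_add le_rfl
            (mul_le_mul' (hpow (by norm_num)) le_rfl)) (mul_le_mul' (hpow (by norm_num)) le_rfl))
            (mul_le_mul' (mul_le_mul' le_rfl (hpow (by norm_num))) le_rfl))
      _ = 9 * c ^ 5 * B₀ := by ring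
  -- the constant of the hierarchy and the total data bound
  set K : ℝ≥0∞ := 3 * c ^ 2 with hKdef
  have hK_top : K < ⊤ := ENNReal.mul_lt_top (by simp) (ENNReal.pow_lt_top hc_top)
  set Kn : ℝ≥0 := K.toNNReal with hKndef
  have hKn : (Kn : ℝ≥0∞) = K := ENNReal.coe_toNNReal hK_top.ne
  have hcK : c ≤ K :=
    calc c ≤ c ^ 2 := hcpow 2 (by norm_num)
      _ = 1 * c ^ 2 := (one_mul _).symm
      _ ≤ 3 * c ^ 2 := mul_le_mul' (by norm_num) le_rfl
  set Dtot : ℝ≥0∞ := 19 * c ^ 6 * B₀ with hDtotdef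
  have hDtot_top : Dtot < ⊤ :=
    ENNReal.mul_lt_top (ENNReal.mul_lt_top (by simp) (ENNReal.pow_lt_top hc_top)) hB₀_top
  -- the right-hand sides of (B1), (B2) below `K (q + F + E₂)(s)`
  have hRHS : ∀ s t, 1 ≤ s → s ≤ t →
      CB * (q s + F s + F t + L s t) ≤ K * (q s + F s + E₂ s) := fun s t hs hst ↦ by
    have hs0 : (0 : ℝ) ≤ s := by linarith
    have h3c : ∀ x : ℝ≥0∞, x ≤ 3 * c * x := fun x ↦
      le_mul_of_one_le_left zero_le (one_le_mul_of_one_le_of_one_le (by norm_num) h1c)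
    calc CB * (q s + F s + F t + L s t)
        ≤ c * (q s + F s + c * F s + (c * E₂ s + c * F s)) :=
          mul_le_mul' hCBc (add_le_add (add_le_add le_rfl
            ((hA1 s t hs0 hst).trans (mul_le_mul' hCAc le_rfl))) (hL s t hs0 hst))
      _ = c * (q s + (1 + 2 * c) * F s + c * E₂ s) := by ring
      _ ≤ c * (3 * c * q s + 3 * c * F s + 3 * c * E₂ s) := by
          refine mul_le_mul' le_rfl (add_le_add (add_le_add (h3c _) ?_) ?_)
          · refine mul_le_mul' ?_ le_rfl
            calc 1 + 2 * c ≤ c + 2 * c := add_le_add h1c le_rfl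
              _ = 3 * c := by ring
          · exact mul_le_mul' (le_mul_of_one_le_left zero_le (by norm_num)) le_rfl
      _ = K * (q s + F s + E₂ s) := by rw [hKdef]; ring
  -- (EB) for `f = F` and `g = E₂` on `[1, ∞)`
  have hf : ∀ s t, 1 ≤ s → s ≤ t → F t ≤ Kn * F s := fun s t hs hst ↦ by
    rw [hKn]
    calc F t ≤ CA * F s := hA1 s t (by linarith) hst
      _ ≤ c * F s := mul_le_mul' hCAc le_rfl
      _ ≤ K * F s := mul_le_mul' hcK le_rfl
  have hg : ∀ s t, 1 ≤ s → s ≤ t → E₂ t ≤ Kn * E₂ s := fun s t hs hst ↦ by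
    rw [hKn]
    calc E₂ t ≤ CA * E₂ s := hA2 s t (by linarith) hst
      _ ≤ c * E₂ s := mul_le_mul' hCAc le_rfl
      _ ≤ K * E₂ s := mul_le_mul' hcK le_rfl
  -- (`p = 1`, boundary terms) for `q`
  have hqq : ∀ s t, 1 ≤ s → s ≤ t → q t ≤ Kn * (q s + F s + E₂ s) := fun s t hs hst ↦ by
    rw [hKn]
    exact (hB1 s t hs hst).trans (hRHS s t hs hst)
  -- (`p = 1`, bulk term, with the local errors absorbed by (A4), (A8)): `∫_{[s,2s]} F`
  have hI : ∀ s, 1 ≤ s → ∫⁻ u in Icc s (2 * s), F u ≤ Kn * (q s + F s + E₂ s) := fun s hs ↦ by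
    rw [hKn]
    exact (hB2 s hs).trans (hRHS s (2 * s) hs (by linarith))
  -- (second order, (A5) with the far fluxes below the total ones): `∫_{[s,2s]} E₂ ≤ Dtot`
  have hJ : ∀ s, 1 ≤ s → ∫⁻ u in Icc s (2 * s), E₂ u ≤ Dtot := fun s hs ↦ by
    have hs0 : (0 : ℝ) ≤ s := by linarith
    have hs2 : s ≤ 2 * s := by linarith
    have hfarψ : ∫⁻ u in Icc s (2 * s), farLeafFlux M a (scriHeight M a R₁) ψ u RA' ≤
        ∫⁻ u in Icc s (2 * s), F u :=
      lintegral_mono fun u ↦ farLeafFlux_le_leafFlux M a _ ψ u RA'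
    have hfarT : ∫⁻ u in Icc s (2 * s), farLeafFlux M a (scriHeight M a R₁) (timeDeriv ψ) u RA' ≤
        ∫⁻ u in Icc s (2 * s), FT u :=
      lintegral_mono fun u ↦ farLeafFlux_le_leafFlux M a _ (timeDeriv ψ) u RA'
    calc ∫⁻ u in Icc s (2 * s), E₂ u
        ≤ CA * (E₃ s + (∫⁻ u in Icc s (2 * s), farLeafFlux M a (scriHeight M a R₁) ψ u RA') +
            ∫⁻ u in Icc s (2 * s), farLeafFlux M a (scriHeight M a R₁) (timeDeriv ψ) u RA') :=
          hA5 s (2 * s) hs0 hs2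
      _ ≤ c * (c * B₀ + 9 * c ^ 5 * B₀ + 9 * c ^ 5 * B₀) :=
          mul_le_mul' hCAc (add_le_add (add_le_add (hE₃ s hs0) (hfarψ.trans (hIF s hs)))
            (hfarT.trans (hIFT s hs)))
      _ ≤ c * (c ^ 5 * B₀ + 9 * c ^ 5 * B₀ + 9 * c ^ 5 * B₀) :=
          mul_le_mul' le_rfl (add_le_add (add_le_add
            (mul_le_mul' (hcpow 5 (by norm_num)) le_rfl) le_rfl) le_rfl)
      _ = Dtot := by rw [hDtotdef]; ring
  -- (`p = 2`): `∫_{[s,2s]} q ≤ Dtot`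
  have hP : ∀ s, 1 ≤ s → ∫⁻ u in Icc s (2 * s), q u ≤ Dtot := fun s hs ↦ by
    have hs2 : (0 : ℝ) ≤ 2 * s := by linarith
    have h12 : (1 : ℝ) ≤ 2 * s := by linarith
    calc ∫⁻ u in Icc s (2 * s), q u ≤ D + CB * (F (2 * s) + L 1 (2 * s)) := hB3 s hs
      _ ≤ B₀ + c * (c ^ 2 * B₀ + 2 * c ^ 3 * B₀) :=
          add_le_add hDB (mul_le_mul' hCBc (add_le_add (hF (2 * s) hs2)
            (hLB 1 (2 * s) zero_le_one h12)))
      _ ≤ c ^ 6 * B₀ + c * (c ^ 5 * B₀ + 2 * c ^ 5 * B₀) :=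
          add_le_add (hB₀c 6) (mul_le_mul' le_rfl (add_le_add
            (mul_le_mul' (hpow (by norm_num)) le_rfl)
            (mul_le_mul' (mul_le_mul' le_rfl (hpow (by norm_num))) le_rfl)))
      _ = 4 * c ^ 6 * B₀ := by ring
      _ ≤ 19 * c ^ 6 * B₀ := mul_le_mul' (mul_le_mul' (by norm_num) le_rfl) le_rfl
      _ = Dtot := by rw [hDtotdef]
  -- the data at `τ₀ = 1`
  have h0 : q 1 + F 1 + E₂ 1 ≤ Dtot :=
    calc q 1 + F 1 + E₂ 1 ≤ B₀ + c ^ 2 * B₀ + c * B₀ :=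
          add_le_add (add_le_add (hB4.trans hDB) (hF 1 zero_le_one)) (hE₂ 1 zero_le_one)
      _ ≤ c ^ 6 * B₀ + c ^ 6 * B₀ + c ^ 6 * B₀ :=
          add_le_add (add_le_add (hB₀c 6) (mul_le_mul' (hpow (by norm_num)) le_rfl))
            (mul_le_mul' (hcpow 6 (by norm_num)) le_rfl)
      _ = 3 * (c ^ 6 * B₀) := by ring
      _ ≤ 19 * (c ^ 6 * B₀) := mul_le_mul' (by norm_num) le_rfl
      _ = Dtot := by rw [hDtotdef, mul_assoc]
  -- the dyadic iteration (`DyadicDecay.lean`)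
  have hdec := DafermosRodnianski.sq_decay_of_hierarchy_of_le_one (f := F) (g := E₂) (q := q)
    one_pos le_rfl hf hg hqq hI hJ hP h0
  refine ⟨152 * ((max Kn 1 : ℝ≥0) : ℝ≥0∞) ^ 6 * Dtot, ?_, fun τ hτ ↦ hdec τ hτ⟩
  exact ENNReal.mul_lt_top (ENNReal.mul_lt_top (by simp) (ENNReal.pow_lt_top ENNReal.coe_lt_top))
    hDtot_top

end assembly

end Kerr

/-! ### Consequences for the gr.S24 facts of `BlackHoles.lean` -/

/-- **gr.S24 polynomial local-energy decay from DRSR Theorems 3.1–3.2 and the `r^p` estimates**: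
`Kerr.drsr_theorems_3_1_3_2_scri → Kerr.dafermosRodnianski_pHierarchy_scri →
drsr_wave_polynomial_decay_kerr` (through `Kerr.drsr_corollary_3_1_scri_flux_decay_of_hierarchy`
and `drsr_wave_polynomial_decay_kerr_of_corollary_3_1_scri` of `KerrHyperboloidalFlux.lean`).
DRSR arXiv:1402.7034, §3.3. [cite: DafermosRodnianskiShlapentokhrothman2014, §3.3 Cor. 3.1] -/
theorem drsr_wave_polynomial_decay_kerr_of_hierarchy (hA : Kerr.drsr_theorems_3_1_3_2_scri)
    (hB : Kerr.dafermosRodnianski_pHierarchy_scri) : drsr_wave_polynomial_decay_kerr :=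
  drsr_wave_polynomial_decay_kerr_of_corollary_3_1_scri
    (Kerr.drsr_corollary_3_1_scri_flux_decay_of_hierarchy hA hB)

/-- **gr.S24 local energy decay from DRSR Theorems 3.1–3.2 and the `r^p` estimates**
(`drsr_wave_local_energy_decay_kerr`, via `drsr_wave_local_energy_decay_kerr_of_polynomial_decay`
of `BlackHoles.lean`). DRSR arXiv:1402.7034, §3.3. [cite: DafermosRodnianskiShlapentokhrothman2014, §3.3 Cor. 3.1] -/
theorem drsr_wave_local_energy_decay_kerr_of_hierarchy (hA : Kerr.drsr_theorems_3_1_3_2_scri)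
    (hB : Kerr.dafermosRodnianski_pHierarchy_scri) : drsr_wave_local_energy_decay_kerr :=
  drsr_wave_local_energy_decay_kerr_of_polynomial_decay
    (drsr_wave_polynomial_decay_kerr_of_hierarchy hA hB)

end Literature.Geometry.Lorentzian

end
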